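import Summits.ResolutionOfSingularities.ResolutionOfSingularities.Theorems.MarkedIdealsSolidSplit
import Literature.AlgebraicGeometry.Resolution.SubschemeRegularStalks
import HarnessLib

/-!
# The solid part of a marked ideal is a weakly permissible centre

Topic: `Literature/AlgebraicGeometry/Resolution` (TOOL, decomp-res lens-6 g30; continuation of
`Theorems/MarkedIdealsSolidSplit.lean`, landed under `Summits/…/Theorems/` like its predecessors, namespace
`Literature.AlgebraicGeometry.Resolution.MarkedIdeal` unchanged). For a marked ideal `(𝓘, n)` with `1 ≤ n` and
`ord 𝓘 ≤ n` everywhere on a regular scheme `X` (Noetherian underlying space, closed support): at a point `x` under the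
(unique, `MarkedIdeal.eq_of_coheight_eq_one_of_specializes`) codimension-`1` support point `ζ` the germ of the ideal of
the solid part `MarkedIdeal.solidPart` is `𝔭_ζ` (`MarkedIdeal.stalkIdeal_vanishingIdeal_solidPart`; Stacks 01J7 for the
germ of the ideal of a closed set) and `𝓘_x = 𝔭_ζ ^ n` (`MarkedIdeal.stalkIdeal_eq_stalkIdeal_vanishingIdeal_solidPart_pow`);
hence the reduced subscheme on the solid part is REGULAR (`MarkedIdeal.isRegular_subscheme_vanishingIdeal_solidPart`,
via `IsRegularLocalRing.quotient_span_singleton`) and lies in the support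
(`MarkedIdeal.support_vanishingIdeal_solidPart_subset`) — it is a weakly permissible centre (first consumer: the F-solid
letter of the g31 «SurfCut» frame of `E1TopGHeavy`, which blows it up via `blowup_facts`).

References: The Stacks Project, Tags 01J7, 00NQ, 0AFS; A. Grothendieck, EGA IV₁ §0.16–17 (regular local rings);
E. Bierstone, D. Grigoriev, P. Milman, J. Włodarczyk, arXiv:1206.3090, §3.1–3.2 (marked ideals, supports, admissible
centres). [new; elementary] [folklore]
-/

noncomputable section

open CategoryTheory CategoryTheory.Limits AlgebraicGeometry TopologicalSpace Topology Order IsLocalRing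

namespace Literature.AlgebraicGeometry.Resolution

universe u

open Scheme.IdealSheafData

section SolidCentre

/-! #### §SolidCentre — THE SOLID PART IS A PERMISSIBLE CENTRE: at a point `x` under the (unique) codimension-`1` support
point `ζ`, the germ of the ideal of the solid part is `𝔭_ζ = (p)` and the germ of the marked ideal is `(p) ^ n`; hence
the reduced subscheme on the solid part is REGULAR (a disjoint union of regular prime divisors) and lies in the support
— the F-solid letter of the g31 «SurfCut» frame blows it up (`blowup_facts`). -/

variable {X : Scheme.{u}}

namespace MarkedIdeal

variable {M : MarkedIdeal X}

/-- **uniqueness of the codimension-`1` support point over a solid point.** [folklore] -/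
theorem eq_of_coheight_eq_one_of_specializes (hX : Scheme.IsRegular X) (hn1 : 1 ≤ M.mult)
    (hord : ∀ y : X, idealOrder M.ideal y ≤ (M.mult : ℕ∞)) {ζ ζ' x : X} (hζ : Order.coheight ζ = 1) (hζS : ζ ∈ M.support)
    (h : ζ ⤳ x) (hζ' : Order.coheight ζ' = 1) (hζ'S : ζ' ∈ M.support) (h' : ζ' ⤳ x) : ζ = ζ' :=
  eq_of_specializes_of_coheight_eq_one'
    (specializes_of_mem_support_of_coheight_eq_one hX M hn1 hord hζ hζS h h' hζ'S) hζ' (by rw [hζ]; exact one_ne_zero)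

/-- a codimension-`1` support point lies in the solid part. [folklore] -/
theorem mem_solidPart_of_coheight_eq_one {ζ : X} (hζ : Order.coheight ζ = 1) (hζS : ζ ∈ M.support) : ζ ∈ M.solidPart :=
  ⟨hζS, ζ, hζS, hζ, specializes_rfl⟩

/-- **THE GERM OF THE IDEAL OF THE SOLID PART at a point under `ζ` is `𝔭_ζ`**: `𝓘(solid)_x ≤ 𝔭_ζ` because `ζ` lies on
the solid part; conversely `𝓘(solid)_x` is radical (`stalkIdeal_vanishingIdeal_eq_vanishingIdeal_setOf`) and each of its
minimal primes is `𝔭_η` for a maximal point `η` of the solid part over `x` (`exists_isMax_of_mem_minimalPrimes`), under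
which the solid clause forces `ζ ⤳ η`. [new] [folklore] -/
theorem stalkIdeal_vanishingIdeal_solidPart [NoetherianSpace X] (hX : Scheme.IsRegular X) (hn1 : 1 ≤ M.mult)
    (hord : ∀ y : X, idealOrder M.ideal y ≤ (M.mult : ℕ∞)) (hS : IsClosed M.support) {ζ x : X}
    (hζ : Order.coheight ζ = 1) (hζS : ζ ∈ M.support) (h : ζ ⤳ x) :
    stalkIdeal (vanishingIdeal ⟨M.solidPart, isClosed_solidPart hX hn1 hord hS⟩) x = primeOfSpecializes h := by
  apply le_antisymm
  · exact stalkIdeal_vanishingIdeal_le h (mem_solidPart_of_coheight_eq_one hζ hζS)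
  · have hrad : (stalkIdeal (vanishingIdeal ⟨M.solidPart, isClosed_solidPart hX hn1 hord hS⟩) x).IsRadical := by
      rw [stalkIdeal_vanishingIdeal_eq_vanishingIdeal_setOf]
      exact PrimeSpectrum.isRadical_vanishingIdeal _
    rw [← hrad.radical, ← Ideal.sInf_minimalPrimes]
    refine le_sInf fun P hP => ?_
    obtain ⟨η, hη, hηS, -, rfl⟩ := exists_isMax_of_mem_minimalPrimes hP
    obtain ⟨-, ζ', hζ'S, hζ', hζ'η⟩ := hηS
    have heq : ζ = ζ' := eq_of_coheight_eq_one_of_specializes hX hn1 hord hζ hζS h hζ' hζ'S (hζ'η.trans hη)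
    subst heq
    exact primeOfSpecializes_mono hη hζ'η

/-- **THE GERM OF THE MARKED IDEAL along the solid part is the `n`-th power of the germ of the solid part**:
`𝓘_x = (p ^ n) = 𝔭_ζ ^ n = 𝓘(solid)_x ^ n`. [new] [folklore] -/
theorem stalkIdeal_eq_stalkIdeal_vanishingIdeal_solidPart_pow [NoetherianSpace X] (hX : Scheme.IsRegular X)
    (hn1 : 1 ≤ M.mult) (hord : ∀ y : X, idealOrder M.ideal y ≤ (M.mult : ℕ∞)) (hS : IsClosed M.support) {ζ x : X}
    (hζ : Order.coheight ζ = 1) (hζS : ζ ∈ M.support) (h : ζ ⤳ x) :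
    stalkIdeal M.ideal x = stalkIdeal (vanishingIdeal ⟨M.solidPart, isClosed_solidPart hX hn1 hord hS⟩) x ^ M.mult := by
  obtain ⟨p, -, hpeq, -, hIx⟩ := exists_generator_of_mem_support_of_coheight_eq_one hX M hn1 hord hζ hζS h
  rw [stalkIdeal_vanishingIdeal_solidPart hX hn1 hord hS hζ hζS h, hpeq, Ideal.span_singleton_pow, hIx]

/-- the support of the ideal of the solid part is the solid part. [folklore] -/
theorem coe_support_vanishingIdeal_solidPart [NoetherianSpace X] (hX : Scheme.IsRegular X) (hn1 : 1 ≤ M.mult)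
    (hord : ∀ y : X, idealOrder M.ideal y ≤ (M.mult : ℕ∞)) (hS : IsClosed M.support) :
    ((vanishingIdeal ⟨M.solidPart, isClosed_solidPart hX hn1 hord hS⟩).support : Set X) = M.solidPart :=
  Scheme.IdealSheafData.coe_support_vanishingIdeal _

/-- **THE SOLID PART IS A WEAKLY PERMISSIBLE CENTRE, I: it lies in the support.** [folklore] -/
theorem support_vanishingIdeal_solidPart_subset [NoetherianSpace X] (hX : Scheme.IsRegular X) (hn1 : 1 ≤ M.mult)
    (hord : ∀ y : X, idealOrder M.ideal y ≤ (M.mult : ℕ∞)) (hS : IsClosed M.support) :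
    ((vanishingIdeal ⟨M.solidPart, isClosed_solidPart hX hn1 hord hS⟩).support : Set X) ⊆ M.support := by
  rw [coe_support_vanishingIdeal_solidPart hX hn1 hord hS]; exact solidPart_subset_support M

/-- **THE SOLID PART IS A WEAKLY PERMISSIBLE CENTRE, II: its reduced subscheme is REGULAR** (at each of its points the
quotient stalk is `𝒪_x ⧸ 𝔭_ζ = 𝒪_x ⧸ (p)` with `p ∉ 𝔪_x²`, `isRegularLocalRing_stalk_quotient_primeOfSpecializes`;
`Scheme.isRegular_subscheme_of_forall`). [new] [folklore] -/
theorem isRegular_subscheme_vanishingIdeal_solidPart [IsLocallyNoetherian X] [NoetherianSpace X]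
    (hX : Scheme.IsRegular X) (hn1 : 1 ≤ M.mult) (hord : ∀ y : X, idealOrder M.ideal y ≤ (M.mult : ℕ∞))
    (hS : IsClosed M.support) :
    Scheme.IsRegular (vanishingIdeal ⟨M.solidPart, isClosed_solidPart hX hn1 hord hS⟩).subscheme := by
  refine Scheme.isRegular_subscheme_of_forall _ fun x hx => ?_
  have hx' : x ∈ M.solidPart := by
    rw [← coe_support_vanishingIdeal_solidPart hX hn1 hord hS]; exact hx
  obtain ⟨-, ζ, hζS, hζ, h⟩ := hx'
  rw [stalkIdeal_vanishingIdeal_solidPart hX hn1 hord hS hζ hζS h]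
  exact isRegularLocalRing_stalk_quotient_primeOfSpecializes hX hn1 hord hζ hζS h

end MarkedIdeal

end SolidCentre

end Literature.AlgebraicGeometry.Resolution

end
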